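import Literature.Geometry.Riemannian.ShrinkingSphereMCF
import Mathlib.Analysis.LocallyConvex.Separation
import HarnessLib

/-!
# Extinction and confinement of the level set flow: `F_t(K₀) = ∅` for `t > R²/(2n)`,
# `F_t(K₀) ⊆ conv(K₀)` (Evans–Spruck 1991, Thm. 7.1)

Topic `Literature/Geometry/Riemannian`. The first theorems ABOUT the tree's level set flow
`Literature.Geometry.Riemannian.levelSetFlow` (White's biggest weak set flow, `MeanConvexLevelSetFlow.lean`)
beyond its defining maximality: comparison with the shrinking round spheres of
`ShrinkingSphereMCF.lean` (`IsWeakSetFlowIn.disjoint_sphere_sqrt`, an instance of the avoidance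
clause of Hershkovits–White's Def. 19) gives, for hypersurfaces of `ℝⁿ⁺¹` (`n ≥ 1`) and the
Euclidean metric:

* `IsWeakSetFlowIn.subset_ball_sqrt`, `levelSetFlow_subset_ball` — **confinement to shrinking
  balls**: `K₀ ⊆ ball c r₀ ⇒ F_t(K₀) ⊆ ball c √(r₀² - 2nt)` for `2nt < r₀²`;
* `IsWeakSetFlowIn.eq_empty_of_lt`, `levelSetFlow_eq_empty_of_lt` — **finite extinction**
  (Evans–Spruck 1991, Thm. 7.1 (a): "If `Γ₀ ⊂ B(0, R)`, then `Γ_t = ∅` for `t > R²/(2(n-1))`" —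
  there `Γ₀ ⊂ ℝⁿ`, here hypersurfaces of `ℝⁿ⁺¹`, so `2n t`; "by making comparisons with the
  shrinking sphere", cf. Brakke 1978, 3.7): `K₀ ⊆ ball c r₀ ⇒ F_t(K₀) = ∅` for `t > r₀²/(2n)`;
  hence `arrivalTime ≤ r₀²/(2n)`, `extinctionTime ≤ r₀²/(2n)` (`extinctionTime_le_of_subset_ball`,
  `extinctionTime_lt_top_of_isBounded`: **bounded sets have finite extinction time**);
* `IsWeakSetFlowIn.inner_le_of_forall_inner_le`, `levelSetFlow_inner_le` — **closed half-spaces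
  containing a bounded `K₀` contain `F_t(K₀)`** (comparison with large spheres: a bounded set in
  `{⟪·, u⟫ ≤ β'}` lies in the ball of radius `R` about `β u - R u` for `R` large, which lies in
  `{⟪·, u⟫ < β}` and only shrinks);
* `levelSetFlow_subset_closure_convexHull` — **Evans–Spruck 1991, Thm. 7.1 (b)**:
  `F_t(K₀) ⊆ closure (conv K₀)` for bounded `K₀` (geometric Hahn–Banach separation of a point
  from the closed convex hull by a closed half-space).

The centre of the extinction argument needs one extra idea not in the printed proof (which
works with the viscosity formulation): the centre `c` itself is excluded at times
`t > r₀²/(2n)` by a sphere about a nearby centre `c + δ e₀` (`IsWeakSetFlowIn.eq_empty_of_lt`).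
Everything is PROVED from the definitions; no named facts. The statements hold for every subset
`K₀` of a ball (no closedness needed) because `levelSetFlow` is defined as a union of weak set
flows, each of which obeys avoidance.

## References

* [EvansSpruck1991] L. C. Evans, J. Spruck, *Motion of level sets by mean curvature. I*,
  J. Differential Geom. 33 (1991) 635–681, §7.1, Thm. 7.1 (a), (b) and its proof (held text
  `paper:doi-10-4310-jdg-1214446559`, pp. 31–32).
* [White2000] B. White, J. Amer. Math. Soc. 13 (2000), §2 (weak set flows, avoidance).
* [HershkovitsWhite2019] O. Hershkovits, B. White, Comm. Pure Appl. Math. 73 (2020), App. Def. 19.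
* K. A. Brakke, *The motion of a surface by its mean curvature*, Princeton 1978, 3.7 (sphere
  comparison).
-/

noncomputable section

open Bundle Set Function Metric Module Filter
open scoped Manifold ContDiff Topology RealInnerProductSpace

namespace Literature.Geometry.Riemannian

open Lorentzian Lorentzian.PseudoRiemannianMetric

set_option hygiene false in
/-- `𝕍` : the ambient space `ℝⁿ⁺¹ = EuclideanSpace ℝ (Fin (n + 1))` (local notation). -/
local notation "𝕍" => EuclideanSpace ℝ (Fin (n + 1))

/-! ### Extinction inside a ball (Evans–Spruck 1991, Thm. 7.1 (a)) -/

section Extinction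

variable {n : ℕ}

open scoped ENNReal

/-- **Sphere comparison, the basic contradiction.** Let `K` be a weak set flow in `ℝⁿ⁺¹` on
`I ⊇ [a, t]` with `K a ⊆ ball c r₀`. A point `x ∈ K t` at distance `ρ > 0` from `c` with
`ρ² + 2n(t - a) ≥ r₀²` is impossible: the sphere of radius `√(ρ² + 2n(t-a)) ≥ r₀` about `c` at time
`a` misses `K a` and shrinks exactly to the sphere of radius `ρ` through `x` at time `t`
(`IsWeakSetFlowIn.disjoint_sphere_sqrt`). [cite: EvansSpruck1991, Thm. 7.1 (a), proof] -/
theorem IsWeakSetFlowIn.false_of_mem_of_le (hn : 1 ≤ n) {I : Set ℝ} {K : ℝ → Set 𝕍}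
    (hK : IsWeakSetFlowIn (euclideanMetric 𝕍) univ I K) {c : 𝕍} {r₀ a t : ℝ}
    (h0 : K a ⊆ ball c r₀) (hat : a ≤ t) (hI : Icc a t ⊆ I) {x : 𝕍} (hx : x ∈ K t)
    (hρ : 0 < dist x c) (hr : r₀ ^ 2 ≤ dist x c ^ 2 + 2 * n * (t - a)) : False := by
  set ρ : ℝ := dist x c with hρ_def
  set r : ℝ := Real.sqrt (ρ ^ 2 + 2 * n * (t - a)) with hr_def
  have hn0 : (0 : ℝ) ≤ n := Nat.cast_nonneg n
  have hta : 0 ≤ t - a := sub_nonneg.2 hat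
  have hr2 : r ^ 2 = ρ ^ 2 + 2 * n * (t - a) := Real.sq_sqrt (by positivity)
  have hrpos : 0 < r := Real.sqrt_pos.2 (by positivity)
  have hsr : 2 * n * (t - a) < r ^ 2 := by rw [hr2]; nlinarith
  have hr₀r : r₀ ≤ r := by
    by_contra hlt
    rw [not_le] at hlt
    have : r ^ 2 < r₀ ^ 2 := by nlinarith
    linarith
  -- the sphere of radius `r` about `c` misses `K a ⊆ ball c r₀`
  have ha : Disjoint (sphere c r) (K a) := by
    refine Set.disjoint_left.2 fun y hy hyK ↦ ?_
    have h1 : dist y c < r₀ := h0 hyK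
    rw [mem_sphere] at hy
    linarith
  have h := hK.disjoint_sphere_sqrt hn c hrpos hta hsr (by rwa [add_sub_cancel]) (fun _ _ ↦ subset_univ _) ha
  rw [add_sub_cancel, hr2, add_sub_cancel_right, Real.sqrt_sq dist_nonneg] at h
  exact Set.disjoint_left.1 h (mem_sphere.2 rfl) hx

/-- **Weak set flows stay in shrinking balls** (comparison with the shrinking sphere): if
`K a ⊆ ball c r₀` then `K t ⊆ ball c √(r₀² - 2n(t - a))` for `a ≤ t` with `2n(t - a) < r₀²`
(`[a, t] ⊆ I`). [cite: EvansSpruck1991, Thm. 7.1 (a), proof] -/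
theorem IsWeakSetFlowIn.subset_ball_sqrt (hn : 1 ≤ n) {I : Set ℝ} {K : ℝ → Set 𝕍}
    (hK : IsWeakSetFlowIn (euclideanMetric 𝕍) univ I K) {c : 𝕍} {r₀ a t : ℝ}
    (h0 : K a ⊆ ball c r₀) (hat : a ≤ t) (hI : Icc a t ⊆ I) (ht : 2 * n * (t - a) < r₀ ^ 2) :
    K t ⊆ ball c (Real.sqrt (r₀ ^ 2 - 2 * n * (t - a))) := by
  intro x hx
  rw [mem_ball]
  by_contra hge
  rw [not_lt] at hge
  have hm : 0 < Real.sqrt (r₀ ^ 2 - 2 * n * (t - a)) := Real.sqrt_pos.2 (by linarith)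
  have hρ : 0 < dist x c := hm.trans_le hge
  refine hK.false_of_mem_of_le hn h0 hat hI hx hρ ?_
  have h2 : Real.sqrt (r₀ ^ 2 - 2 * n * (t - a)) ^ 2 = r₀ ^ 2 - 2 * n * (t - a) :=
    Real.sq_sqrt (by linarith)
  nlinarith [hge, hm]

/-- **Extinction of weak set flows** (Evans–Spruck 1991, Thm. 7.1 (a): "If `Γ₀ ⊂ B(0, R)`, then
`Γ_t = ∅` for `t > R²/(2n)`", here for hypersurfaces of `ℝⁿ⁺¹`; cf. Brakke 1978, 3.7): if
`K a ⊆ ball c r₀` and `r₀² < 2n(t - a)` (`[a, t] ⊆ I`) then `K t = ∅`. Points `x ≠ c` are excluded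
by the sphere about `c` through `x`; the centre itself by a sphere about a nearby centre
`c + δ e₀`. [cite: EvansSpruck1991, Thm. 7.1 (a)] -/
theorem IsWeakSetFlowIn.eq_empty_of_lt (hn : 1 ≤ n) {I : Set ℝ} {K : ℝ → Set 𝕍}
    (hK : IsWeakSetFlowIn (euclideanMetric 𝕍) univ I K) {c : 𝕍} {r₀ a t : ℝ}
    (h0 : K a ⊆ ball c r₀) (hat : a ≤ t) (hI : Icc a t ⊆ I) (ht : r₀ ^ 2 < 2 * n * (t - a)) :
    K t = ∅ := by
  refine Set.eq_empty_of_forall_notMem fun x hx ↦ ?_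
  by_cases hxc : x = c
  · -- move the centre to `c' = c + δ e₀`, `δ > 0` small, and enlarge the radius to `r₀ + δ`
    subst hxc
    set δ : ℝ := (2 * n * (t - a) - r₀ ^ 2) / (2 * |r₀| + 1) with hδ
    have hD : 0 < 2 * |r₀| + 1 := by positivity
    have hδpos : 0 < δ := div_pos (by linarith) hD
    have hδle : r₀ ^ 2 + 2 * r₀ * δ ≤ 2 * n * (t - a) := by
      have h1 : 2 * r₀ * δ ≤ (2 * |r₀| + 1) * δ := by
        have : 2 * r₀ ≤ 2 * |r₀| + 1 := by linarith [le_abs_self r₀]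
        exact mul_le_mul_of_nonneg_right this hδpos.le
      have h2 : (2 * |r₀| + 1) * δ = 2 * n * (t - a) - r₀ ^ 2 := by
        rw [hδ]
        field_simp
      linarith
    set e₀ : 𝕍 := EuclideanSpace.basisFun (Fin (n + 1)) ℝ 0 with he₀_def
    have he₀ : ‖e₀‖ = 1 := (EuclideanSpace.basisFun (Fin (n + 1)) ℝ).orthonormal.1 0
    set c' : 𝕍 := x + δ • e₀ with hc'
    have hdist : dist x c' = δ := by
      rw [hc', dist_eq_norm, sub_add_cancel_left, norm_neg, norm_smul, he₀, mul_one,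
        Real.norm_of_nonneg hδpos.le]
    have h0' : K a ⊆ ball c' (r₀ + δ) := fun y hy ↦ by
      have h1 : dist y x < r₀ := h0 hy
      rw [mem_ball]
      calc dist y c' ≤ dist y x + dist x c' := dist_triangle _ _ _
        _ < r₀ + δ := by rw [hdist]; linarith
    refine hK.false_of_mem_of_le hn h0' hat hI hx (by rw [hdist]; exact hδpos) ?_
    rw [hdist]
    nlinarith [hδle]
  · have hρ : 0 < dist x c := dist_pos.2 hxc
    exact hK.false_of_mem_of_le hn h0 hat hI hx hρ (by nlinarith [sq_nonneg (dist x c)])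

/-- **The level set flow of a set in a ball stays in the shrinking balls**:
`K₀ ⊆ ball c r₀ ⇒ F_t(K₀) ⊆ ball c √(r₀² - 2nt)` for `2nt < r₀²`.
[cite: EvansSpruck1991, Thm. 7.1 (a), proof] -/
theorem levelSetFlow_subset_ball (hn : 1 ≤ n) {K₀ : Set 𝕍} {c : 𝕍} {r₀ : ℝ} (hK₀ : K₀ ⊆ ball c r₀)
    {t : ℝ} (ht : 2 * n * t < r₀ ^ 2) :
    levelSetFlow (euclideanMetric 𝕍) K₀ t ⊆ ball c (Real.sqrt (r₀ ^ 2 - 2 * n * t)) := by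
  rintro x ⟨ht0, K, hK, hK0, hx⟩
  have h := hK.subset_ball_sqrt hn (hK0.trans hK₀) ht0 (fun s hs ↦ hs.1) (by rwa [sub_zero]) hx
  rwa [sub_zero] at h

/-- **Finite extinction of the level set flow (Evans–Spruck 1991, Thm. 7.1 (a))**, for the tree's
level set flow `levelSetFlow` (White's biggest flow) of ANY subset of a ball of `ℝⁿ⁺¹`:
`K₀ ⊆ ball c r₀ ⇒ F_t(K₀) = ∅` for `t > r₀²/(2n)`. [cite: EvansSpruck1991, Thm. 7.1 (a)] -/
theorem levelSetFlow_eq_empty_of_lt (hn : 1 ≤ n) {K₀ : Set 𝕍} {c : 𝕍} {r₀ : ℝ}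
    (hK₀ : K₀ ⊆ ball c r₀) {t : ℝ} (ht : r₀ ^ 2 < 2 * n * t) :
    levelSetFlow (euclideanMetric 𝕍) K₀ t = ∅ := by
  refine Set.eq_empty_of_forall_notMem fun x hx ↦ ?_
  obtain ⟨ht0, K, hK, hK0, hxK⟩ := hx
  have h := hK.eq_empty_of_lt hn (hK0.trans hK₀) ht0 (fun s hs ↦ hs.1) (by rwa [sub_zero])
  rw [h] at hxK
  exact hxK

/-- **Bounded sets have finite extinction time**: if `K₀` is bounded then `F_t(K₀) = ∅` for all
large `t`. [cite: EvansSpruck1991, Thm. 7.1 (a)] -/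
theorem exists_levelSetFlow_eq_empty_of_isBounded (hn : 1 ≤ n) {K₀ : Set 𝕍}
    (hK₀ : Bornology.IsBounded K₀) : ∃ T : ℝ, ∀ t, T < t → levelSetFlow (euclideanMetric 𝕍) K₀ t = ∅ := by
  obtain ⟨r₀, hr₀⟩ := hK₀.subset_ball (0 : 𝕍)
  have hn0 : (0 : ℝ) < n := by exact_mod_cast hn
  refine ⟨r₀ ^ 2 / (2 * n), fun t ht ↦ levelSetFlow_eq_empty_of_lt hn hr₀ ?_⟩
  rwa [div_lt_iff₀ (by positivity), mul_comm] at ht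

/-- **Arrival times are bounded by `r₀²/(2n)`** for sets in `ball c r₀`.
[cite: EvansSpruck1991, Thm. 7.1 (a)] -/
theorem arrivalTime_le_of_subset_ball (hn : 1 ≤ n) {K₀ : Set 𝕍} {c : 𝕍} {r₀ : ℝ}
    (hK₀ : K₀ ⊆ ball c r₀) (x : 𝕍) :
    arrivalTime (euclideanMetric 𝕍) K₀ x ≤ ENNReal.ofReal (r₀ ^ 2 / (2 * n)) := by
  have hn0 : (0 : ℝ) < n := by exact_mod_cast hn
  refine arrivalTime_le fun t ht ↦ ENNReal.ofReal_le_ofReal ?_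
  by_contra hlt
  rw [not_le] at hlt
  have h := levelSetFlow_eq_empty_of_lt hn hK₀ (t := t) (by
    rwa [div_lt_iff₀ (by positivity), mul_comm] at hlt)
  rw [h] at ht
  exact ht

/-- **Finite extinction time**: `T(K₀) ≤ r₀²/(2n)` for `K₀ ⊆ ball c r₀` (the level set flow of a
set in a ball disappears no later than the shrinking sphere of radius `r₀`).
[cite: EvansSpruck1991, Thm. 7.1 (a)] -/
theorem extinctionTime_le_of_subset_ball (hn : 1 ≤ n) {K₀ : Set 𝕍} {c : 𝕍} {r₀ : ℝ}
    (hK₀ : K₀ ⊆ ball c r₀) :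
    extinctionTime (euclideanMetric 𝕍) K₀ ≤ ENNReal.ofReal (r₀ ^ 2 / (2 * n)) :=
  iSup₂_le fun x _ ↦ arrivalTime_le_of_subset_ball hn hK₀ x

/-- In particular the extinction time of a bounded set is finite. [cite: EvansSpruck1991, Thm. 7.1 (a)] -/
theorem extinctionTime_lt_top_of_isBounded (hn : 1 ≤ n) {K₀ : Set 𝕍}
    (hK₀ : Bornology.IsBounded K₀) : extinctionTime (euclideanMetric 𝕍) K₀ < (⊤ : ℝ≥0∞) := by
  obtain ⟨r₀, hr₀⟩ := hK₀.subset_ball (0 : 𝕍)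
  exact (extinctionTime_le_of_subset_ball hn hr₀).trans_lt ENNReal.ofReal_lt_top

/-! ### Half-spaces and the convex hull (Evans–Spruck 1991, Thm. 7.1 (b)) -/

/-- **Weak set flows do not leave half-spaces** (comparison with large spheres, Evans–Spruck 1991,
proof of Thm. 7.1 (b)): if `K a` is bounded and `⟪x, u⟫ ≤ β'` on `K a` for a unit vector `u`,
then `⟪y, u⟫ < β` on `K t` for every `β > β'` (`a ≤ t`, `[a, t] ⊆ I`): `K a` lies in the ball of
radius `R` centred at `β u - R u` for `R` large, which lies in the open half-space `{⟪·, u⟫ < β}`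
and can only shrink. [cite: EvansSpruck1991, Thm. 7.1 (b), proof] -/
theorem IsWeakSetFlowIn.inner_lt_of_forall_inner_le (hn : 1 ≤ n) {I : Set ℝ} {K : ℝ → Set 𝕍}
    (hK : IsWeakSetFlowIn (euclideanMetric 𝕍) univ I K) {a t : ℝ} (hat : a ≤ t)
    (hI : Icc a t ⊆ I) (hb : Bornology.IsBounded (K a)) {u : 𝕍} (hu : ‖u‖ = 1) {β' β : ℝ}
    (hβ : β' < β) (h : ∀ x ∈ K a, ⟪x, u⟫ ≤ β') {y : 𝕍} (hy : y ∈ K t) : ⟪y, u⟫ < β := by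
  obtain ⟨ρ₀, hρ₀⟩ := hb.subset_closedBall (0 : 𝕍)
  set ρ : ℝ := max ρ₀ 0 with hρ
  have hρnn : 0 ≤ ρ := le_max_right _ _
  have hKρ : K a ⊆ closedBall (0 : 𝕍) ρ :=
    hρ₀.trans (closedBall_subset_closedBall (le_max_left _ _))
  set ε : ℝ := β - β' with hε
  have hεpos : 0 < ε := sub_pos.2 hβ
  set D : ℝ := ρ + |β| with hD
  have hDnn : 0 ≤ D := by positivity
  have hn0 : (0 : ℝ) ≤ n := Nat.cast_nonneg n
  have hta : 0 ≤ t - a := sub_nonneg.2 hat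
  have hdiv : 0 ≤ D ^ 2 / (2 * ε) := by positivity
  set R : ℝ := D ^ 2 / (2 * ε) + 2 * n * (t - a) + 1 with hR
  have hR1 : 1 ≤ R := by
    rw [hR]
    nlinarith
  have hRpos : 0 < R := by linarith
  have hRε : D ^ 2 < 2 * R * ε := by
    have h1 : D ^ 2 / (2 * ε) < R := by
      rw [hR]
      nlinarith
    have h2 := (div_lt_iff₀ (by positivity : (0 : ℝ) < 2 * ε)).1 h1
    linarith
  have hRt : 2 * n * (t - a) < R ^ 2 := by nlinarith
  set q₀ : 𝕍 := β • u with hq₀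
  set c : 𝕍 := q₀ - R • u with hc
  have hcu : ⟪c, u⟫ = β - R := by
    rw [hc, hq₀, inner_sub_left, real_inner_smul_left, real_inner_smul_left,
      real_inner_self_eq_norm_sq, hu]
    ring
  -- `K a ⊆ ball c R`
  have h0 : K a ⊆ ball c R := by
    intro x hx
    have hxρ : ‖x‖ ≤ ρ := by simpa using hKρ hx
    have hxq : ‖x - q₀‖ ≤ D := by
      calc ‖x - q₀‖ ≤ ‖x‖ + ‖q₀‖ := norm_sub_le _ _
        _ ≤ ρ + |β| := by
          rw [hq₀, norm_smul, hu, mul_one, Real.norm_eq_abs]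
          exact add_le_add hxρ le_rfl
    have hxu : ⟪x - q₀, u⟫ ≤ -ε := by
      rw [inner_sub_left, hq₀, real_inner_smul_left, real_inner_self_eq_norm_sq, hu]
      have := h x hx
      rw [hε]
      nlinarith
    have hexp : ‖x - c‖ ^ 2 = ‖x - q₀‖ ^ 2 + 2 * R * ⟪x - q₀, u⟫ + R ^ 2 := by
      have hxc : x - c = (x - q₀) + R • u := by
        rw [hc]
        abel
      rw [hxc, norm_add_sq_real, real_inner_smul_right, norm_smul, Real.norm_of_nonneg hRpos.le,
        hu, mul_one]
      ring
    have hlt : ‖x - c‖ ^ 2 < R ^ 2 := by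
      rw [hexp]
      have h1 : ‖x - q₀‖ ^ 2 ≤ D ^ 2 := pow_le_pow_left₀ (norm_nonneg _) hxq 2
      nlinarith [hxu, hRε, hRpos]
    rw [mem_ball, dist_eq_norm]
    exact (abs_lt_of_sq_lt_sq' hlt hRpos.le).2
  -- the flow at time `t` lies in the shrunk ball, hence in `ball c R`, hence in the half-space
  have hyball : y ∈ ball c R := by
    have h1 := hK.subset_ball_sqrt hn h0 hat hI hRt hy
    rw [mem_ball] at h1 ⊢
    refine h1.trans_le (Real.sqrt_le_sqrt (by nlinarith) |>.trans_eq (Real.sqrt_sq hRpos.le))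
  rw [mem_ball, dist_eq_norm] at hyball
  have hyu : ⟪y - c, u⟫ ≤ ‖y - c‖ := by
    have := real_inner_le_norm (y - c) u
    rwa [hu, mul_one] at this
  have : ⟪y, u⟫ = ⟪y - c, u⟫ + ⟪c, u⟫ := by rw [inner_sub_left]; ring
  rw [this, hcu]
  linarith

/-- **Closed half-spaces containing `K a` contain `K t`** (`K a` bounded, any `u`):
`(∀ x ∈ K a, ⟪x, u⟫ ≤ β) → ∀ y ∈ K t, ⟪y, u⟫ ≤ β`. [cite: EvansSpruck1991, Thm. 7.1 (b)] -/
theorem IsWeakSetFlowIn.inner_le_of_forall_inner_le (hn : 1 ≤ n) {I : Set ℝ} {K : ℝ → Set 𝕍}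
    (hK : IsWeakSetFlowIn (euclideanMetric 𝕍) univ I K) {a t : ℝ} (hat : a ≤ t)
    (hI : Icc a t ⊆ I) (hb : Bornology.IsBounded (K a)) (u : 𝕍) {β : ℝ}
    (h : ∀ x ∈ K a, ⟪x, u⟫ ≤ β) {y : 𝕍} (hy : y ∈ K t) : ⟪y, u⟫ ≤ β := by
  by_cases hu : u = 0
  · subst hu
    rw [inner_zero_right]
    by_cases hne : (K a).Nonempty
    · obtain ⟨x, hx⟩ := hne
      simpa using h x hx
    · -- `K a = ∅`: then `K t = ∅` by extinction from the empty ball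
      rw [Set.not_nonempty_iff_eq_empty] at hne
      have h0 : K a ⊆ ball (0 : 𝕍) 0 := by rw [hne]; exact Set.empty_subset _
      have hn0 : (0 : ℝ) < n := by exact_mod_cast hn
      by_cases hta : a = t
      · subst hta
        rw [hne] at hy
        exact absurd hy (Set.notMem_empty y)
      · have hlt : a < t := lt_of_le_of_ne hat hta
        have := hK.eq_empty_of_lt hn h0 hat hI (by nlinarith : (0 : ℝ) ^ 2 < 2 * n * (t - a))
        rw [this] at hy
        exact absurd hy (Set.notMem_empty y)
  · -- normalise `u`
    have hupos : 0 < ‖u‖ := norm_pos_iff.2 hu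
    set v : 𝕍 := ‖u‖⁻¹ • u with hv
    have hvn : ‖v‖ = 1 := by
      rw [hv, norm_smul, norm_inv, norm_norm, inv_mul_cancel₀ hupos.ne']
    have huv : u = ‖u‖ • v := by
      rw [hv, smul_smul, mul_inv_cancel₀ hupos.ne', one_smul]
    have h' : ∀ x ∈ K a, ⟪x, v⟫ ≤ β / ‖u‖ := fun x hx ↦ by
      rw [le_div_iff₀ hupos, hv, real_inner_smul_right]
      have := h x hx
      field_simp
      linarith
    refine le_of_forall_pos_lt_add fun δ hδ ↦ ?_
    have hlt := hK.inner_lt_of_forall_inner_le hn hat hI hb hvn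
      (lt_add_of_pos_right (β / ‖u‖) (div_pos hδ hupos)) h' hy
    rw [huv, real_inner_smul_right]
    have := mul_lt_mul_of_pos_left hlt hupos
    rw [mul_add, mul_div_cancel₀ _ hupos.ne', mul_div_cancel₀ _ hupos.ne'] at this
    linarith

/-- **The level set flow does not leave closed half-spaces containing a bounded `K₀`**:
`(∀ x ∈ K₀, ⟪x, u⟫ ≤ β) → ∀ y ∈ F_t(K₀), ⟪y, u⟫ ≤ β`. [cite: EvansSpruck1991, Thm. 7.1 (b)] -/
theorem levelSetFlow_inner_le (hn : 1 ≤ n) {K₀ : Set 𝕍} (hb : Bornology.IsBounded K₀) (u : 𝕍)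
    {β : ℝ} (h : ∀ x ∈ K₀, ⟪x, u⟫ ≤ β) {t : ℝ} {y : 𝕍}
    (hy : y ∈ levelSetFlow (euclideanMetric 𝕍) K₀ t) : ⟪y, u⟫ ≤ β := by
  obtain ⟨ht0, K, hK, hK0, hyK⟩ := hy
  exact hK.inner_le_of_forall_inner_le hn ht0 (fun s hs ↦ hs.1) (hb.subset hK0) u
    (fun x hx ↦ h x (hK0 hx)) hyK

/-- **Evans–Spruck 1991, Thm. 7.1 (b): `Γ_t ⊆ conv(Γ₀)`**, for the tree's level set flow of a
bounded `K₀ ⊆ ℝⁿ⁺¹`: `F_t(K₀) ⊆ closure (convexHull K₀)` (the closed convex hull; for compact `K₀`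
this is `conv K₀`). A point outside the closed convex hull is strictly separated from it by a
continuous linear functional (geometric Hahn–Banach), i.e. by a closed half-space containing
`K₀`, which the flow does not leave (`levelSetFlow_inner_le`).
[cite: EvansSpruck1991, Thm. 7.1 (b)] -/
theorem levelSetFlow_subset_closure_convexHull (hn : 1 ≤ n) {K₀ : Set 𝕍}
    (hb : Bornology.IsBounded K₀) (t : ℝ) :
    levelSetFlow (euclideanMetric 𝕍) K₀ t ⊆ closure (convexHull ℝ K₀) := by
  intro y hy
  by_contra hyC
  obtain ⟨f, s, hfs, hsy⟩ := geometric_hahn_banach_closed_point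
    (convex_convexHull ℝ K₀).closure isClosed_closure hyC
  set u : 𝕍 := (InnerProductSpace.toDual ℝ 𝕍).symm f with hu
  have hfu : ∀ z : 𝕍, f z = ⟪z, u⟫ := fun z ↦ by
    rw [hu, real_inner_comm, InnerProductSpace.toDual_symm_apply]
  have hK₀ : ∀ x ∈ K₀, ⟪x, u⟫ ≤ s := fun x hx ↦ by
    rw [← hfu]
    exact (hfs x (subset_closure (subset_convexHull ℝ K₀ hx))).le
  have h := levelSetFlow_inner_le hn hb u hK₀ hy
  rw [← hfu] at h
  exact absurd (h.trans_lt hsy) (lt_irrefl _)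

end Extinction

end Literature.Geometry.Riemannian

end
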